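import Literature.RingTheory.KTheory.MilnorKWittRing
import HarnessLib

/-!
# The dimension index `W(F) → ℤ/2`: the fundamental ideal `I` is maximal with `W(F)/I ≅ ℤ/2`; `W(F) ≠ 0`; and
# `W(F) ≅ ℤ/2` for a quadratically closed field (Milnor, *Algebraic K-theory and quadratic forms*, Invent. Math. 9
# (1970), §4)

Family `hodge`, lane `lit-hodgefound` (foundations library; seat `lit-hodgefound-p27`, generation 40, row g40-#20);
topic `RingTheory/KTheory`.  Sequel of `MilnorKWittRing` (g40-#17: `WittRing F` by generators `gen F a = (a)` and
relations `rels`, the fundamental ideal `fundIdeal F = I`, `exists_int_sub_mem`, `two_mem_fundIdeal`, `gen_sq`).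
DEFINITIONS WITH BODIES (`dimLift`, `dimIndex`) and PROVED THEOREMS; no named fact, no instance, no notation,
0 `sorry`, net debt 0 (D-0026).

## The source, verbatim

J. Milnor, *Algebraic K-theory and quadratic forms*, Invent. Math. 9 (1970) 318–344 (held `paper:doi-10-1007-bf01425486`;
bib key `Milnor1970`), Introduction (p0001 L15–L16): «Let W be the Witt ring of anisotropic quadratic modules over
F, and let I ⊂ W be the maximal ideal, consisting of modules of even rank.»  §4 (p0014 L17–L19): «Note that the
augmentation ideal Î in Ŵ maps bijectively to a maximal ideal in W. This image ideal will be denoted by I = IF.»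

## What is formalised

* **`dimIndex F : W(F) →+* ℤ/2`, `(a) ↦ 1`** — the rank modulo `2` (dimension index), well defined on the presented
  Witt ring (all relations have even total coefficient, `dimLift_eq_zero_of_mem_rels`), onto (`dimIndex_surjective`);
* **`mem_fundIdeal_iff : x ∈ I ↔ dimIndex x = 0`** («consisting of modules of even rank»), `ker_dimIndex`, hence
  **`fundIdeal_isMaximal`: `I` is a maximal ideal with `W(F)/I ≅ ℤ/2`**, `fundIdeal_ne_top`;
* consequences: **`one_ne_zero' : W(F) ≠ 0` for every field**, `gen_ne_zero`, `gen_not_mem_fundIdeal` (the `(a)` have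
  odd rank);
* the quadratically closed case (every unit a square): `(a) = 1` (`gen_eq_one_of_isSquare`), `I = 0`
  (`fundIdeal_eq_bot`), so **`dimIndex_bijective : W(F) ≅ ℤ/2`**.

## References

* [Milnor1970] J. Milnor, *Algebraic K-theory and quadratic forms*, Invent. Math. 9 (1970) 318–344 — Introduction
  (p0001 L15–L16); §4, the maximal ideal `I` (p0014 L17–L19).
* [Knebusch2010] M. Knebusch, *Specialization of quadratic and symmetric bilinear forms*, Springer 2010 — Ch. 1,
  Thm. 1.11 (the presentation of `W(F)` used by `MilnorKWittRing`); the dimension index `ν` (PDF p. 16).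

Provenance: lane `lit-hodgefound`, seat `lit-hodgefound-p27` gen 40 (agent `literature-prover-lit-hodgefound-p27-g40-0`),
row g40-#20.
-/

set_option autoImplicit false

noncomputable section

namespace Literature.RingTheory.KTheory

open Function

section DimIndex

variable (F : Type*) [Field F]

namespace WittRing

/-- The rank modulo `2` on the free commutative ring: every generator `(a) ↦ 1 ∈ ℤ/2`. [cite: Milnor1970, §4, the maximal ideal I (p0014 L17–L19)] -/
def dimLift : FreeCommRing Fˣ →+* ZMod 2 := FreeCommRing.lift fun _ => 1

/-- `dimLift (a) = 1`. [cite: Milnor1970, §4, the maximal ideal I (p0014 L17–L19)] -/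
theorem dimLift_og (a : Fˣ) : dimLift F (og F a) = 1 := FreeCommRing.lift_of _ a

/-- All defining relations of `W(F)` have even rank, so the rank mod `2` descends to `W(F)`. [cite: Milnor1970, §4, the maximal ideal I (p0014 L17–L19)] -/
theorem dimLift_eq_zero_of_mem_rels {x : FreeCommRing Fˣ} (hx : x ∈ rels F) : dimLift F x = 0 := by
  rcases hx with ⟨a, b, rfl⟩ | rfl | ⟨a, b, rfl⟩ | ⟨a, rfl⟩ | ⟨a, b, l, m, c, _, rfl⟩
  · rw [map_sub, map_mul, dimLift_og, dimLift_og, dimLift_og, mul_one, sub_self]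
  · rw [map_sub, map_one, dimLift_og, sub_self]
  · rw [map_sub, dimLift_og, dimLift_og, sub_self]
  · rw [map_add, dimLift_og, dimLift_og]; rfl
  · rw [map_sub, map_sub, map_add, dimLift_og, dimLift_og, dimLift_og, dimLift_og]; rfl

/-- **The dimension index `e₀ : W(F) →+* ℤ/2` (rank modulo `2`), `(a) ↦ 1`.** [cite: Milnor1970, Introduction «I ⊂ W the maximal ideal, consisting of modules of even rank» (p0001 L15–L16); §4 «maps bijectively to a maximal ideal in W […] I = IF» (p0014 L17–L19)] -/
def dimIndex : WittRing F →+* ZMod 2 :=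
  Ideal.Quotient.lift (Ideal.span (rels F)) (dimLift F) fun x hx => by
    have h : Ideal.span (rels F) ≤ RingHom.ker (dimLift F) :=
      Ideal.span_le.2 fun y hy => (RingHom.mem_ker).2 (dimLift_eq_zero_of_mem_rels F hy)
    exact (RingHom.mem_ker).1 (h hx)

/-- `e₀((a)) = 1`: one-dimensional forms have odd rank. [cite: Milnor1970, §4, the maximal ideal I (p0014 L17–L19)] -/
theorem dimIndex_gen (a : Fˣ) : dimIndex F (gen F a) = 1 := by
  rw [gen_def, dimIndex, Ideal.Quotient.lift_mk, dimLift_og]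

/-- `e₀` is onto `ℤ/2`. [cite: Milnor1970, §4, the maximal ideal I (p0014 L17–L19)] -/
theorem dimIndex_surjective : Function.Surjective (dimIndex F) := fun z => by
  fin_cases z
  · exact ⟨0, map_zero _⟩
  · exact ⟨1, map_one _⟩

/-- `e₀((a) − (1)) = 0`. [cite: Milnor1970, §4, the maximal ideal I (p0014 L17–L19)] -/
theorem dimIndex_gen_sub_one (a : Fˣ) : dimIndex F (gen F a - 1) = 0 := by rw [map_sub, map_one, dimIndex_gen, sub_self]

/-- `I ⊆ ker e₀`: elements of `I` have even rank. [cite: Milnor1970, Introduction «I ⊂ W the maximal ideal, consisting of modules of even rank» (p0001 L15–L16); §4 «maps bijectively to a maximal ideal in W […] I = IF» (p0014 L17–L19)] -/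
theorem dimIndex_eq_zero_of_mem {x : WittRing F} (hx : x ∈ fundIdeal F) : dimIndex F x = 0 := by
  have h : fundIdeal F ≤ RingHom.ker (dimIndex F) := by
    rw [fundIdeal, Ideal.span_le]
    rintro _ ⟨a, rfl⟩
    exact (RingHom.mem_ker).2 (dimIndex_gen_sub_one F a)
  exact (RingHom.mem_ker).1 (h hx)

/-- **`I = ker e₀`: «I ⊂ W […] consisting of modules of even rank».** [cite: Milnor1970, Introduction «I ⊂ W the maximal ideal, consisting of modules of even rank» (p0001 L15–L16); §4 «maps bijectively to a maximal ideal in W […] I = IF» (p0014 L17–L19)] -/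
theorem mem_fundIdeal_iff (x : WittRing F) : x ∈ fundIdeal F ↔ dimIndex F x = 0 := by
  refine ⟨dimIndex_eq_zero_of_mem F, fun h => ?_⟩
  obtain ⟨k, hk⟩ := exists_int_sub_mem F x
  have h1 : dimIndex F (k : WittRing F) = 0 := by
    have := dimIndex_eq_zero_of_mem F hk
    rwa [map_sub, h, zero_sub, neg_eq_zero] at this
  rw [map_intCast, ZMod.intCast_zmod_eq_zero_iff_dvd] at h1
  obtain ⟨j, hj⟩ := h1
  have h2 : (k : WittRing F) ∈ fundIdeal F := by
    rw [hj]; push_cast; exact Ideal.mul_mem_right _ _ (two_mem_fundIdeal F)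
  have h3 := add_mem hk h2
  rwa [sub_add_cancel] at h3

/-- `ker e₀ = I`. [cite: Milnor1970, Introduction «I ⊂ W the maximal ideal, consisting of modules of even rank» (p0001 L15–L16); §4 «maps bijectively to a maximal ideal in W […] I = IF» (p0014 L17–L19)] -/
theorem ker_dimIndex : RingHom.ker (dimIndex F) = fundIdeal F := by
  ext x; rw [RingHom.mem_ker, mem_fundIdeal_iff]

/-- **«a maximal ideal in W»: `I` is maximal, `W(F)/I ≅ ℤ/2`.** [cite: Milnor1970, Introduction «I ⊂ W the maximal ideal, consisting of modules of even rank» (p0001 L15–L16); §4 «maps bijectively to a maximal ideal in W […] I = IF» (p0014 L17–L19)] -/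
theorem fundIdeal_isMaximal : (fundIdeal F).IsMaximal := by
  rw [← ker_dimIndex]
  exact RingHom.ker_isMaximal_of_surjective (dimIndex F) (dimIndex_surjective F)

/-- `I ≠ W(F)`. [cite: Milnor1970, Introduction «I ⊂ W the maximal ideal, consisting of modules of even rank» (p0001 L15–L16); §4 «maps bijectively to a maximal ideal in W […] I = IF» (p0014 L17–L19)] -/
theorem fundIdeal_ne_top : fundIdeal F ≠ ⊤ := (fundIdeal_isMaximal F).ne_top

/-- **`W(F)` is not the zero ring**, for every field `F`. [cite: Milnor1970, §4, the maximal ideal I (p0014 L17–L19)] -/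
theorem one_ne_zero' : (1 : WittRing F) ≠ 0 := fun h => by
  have := congrArg (dimIndex F) h
  rw [map_one, map_zero] at this
  exact one_ne_zero this

/-- `(a) ≠ 0` in `W(F)`. [cite: Milnor1970, §4, the maximal ideal I (p0014 L17–L19)] -/
theorem gen_ne_zero (a : Fˣ) : gen F a ≠ 0 := fun h => by
  have := congrArg (dimIndex F) h
  rw [dimIndex_gen, map_zero] at this
  exact one_ne_zero this

/-- `(a) ∉ I` (odd rank). [cite: Milnor1970, Introduction «I ⊂ W the maximal ideal, consisting of modules of even rank» (p0001 L15–L16); §4 «maps bijectively to a maximal ideal in W […] I = IF» (p0014 L17–L19)] -/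
theorem gen_not_mem_fundIdeal (a : Fˣ) : gen F a ∉ fundIdeal F := by
  rw [mem_fundIdeal_iff, dimIndex_gen]; exact one_ne_zero

/-! ### quadratically closed fields: `W(F) = ℤ/2` -/

/-- `(b²) = (1) = 1`: square units give the unit form. [cite: Knebusch2010, Ch. 1 Thm. 1.11 (PDF p. 16)] -/
theorem gen_eq_one_of_isSquare {a : Fˣ} (h : IsSquare a) : gen F a = 1 := by
  obtain ⟨b, rfl⟩ := h
  rw [← pow_two, gen_sq]

/-- If every unit of `F` is a square (quadratically closed) then `I = 0`. [cite: Milnor1970, §4, the maximal ideal I (p0014 L17–L19)] -/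
theorem fundIdeal_eq_bot (h : ∀ a : Fˣ, IsSquare a) : fundIdeal F = ⊥ := by
  rw [fundIdeal, Ideal.span_eq_bot]
  rintro _ ⟨a, rfl⟩
  change gen F a - 1 = 0
  rw [gen_eq_one_of_isSquare F (h a), sub_self]

/-- **For a quadratically closed field the dimension index is an isomorphism `W(F) ≅ ℤ/2`** (`I = 0` and `W/I = ℤ/2`). [cite: Milnor1970, Introduction «I ⊂ W the maximal ideal, consisting of modules of even rank» (p0001 L15–L16); §4 «maps bijectively to a maximal ideal in W […] I = IF» (p0014 L17–L19)] -/
theorem dimIndex_bijective (h : ∀ a : Fˣ, IsSquare a) : Function.Bijective (dimIndex F) := by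
  refine ⟨(injective_iff_map_eq_zero _).2 fun x hx => ?_, dimIndex_surjective F⟩
  have := (mem_fundIdeal_iff F x).2 hx
  rwa [fundIdeal_eq_bot F h, Ideal.mem_bot] at this

end WittRing

end DimIndex

end Literature.RingTheory.KTheory

end
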